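import Mathlib.NumberTheory.Padics.RingHoms
import Mathlib.NumberTheory.Padics.ProperSpace
import Mathlib.Topology.Algebra.OpenSubgroup
import Mathlib.Topology.MetricSpace.Ultra.Basic
import Mathlib.FieldTheory.Galois.Infinite
import Mathlib.Data.Int.GCD
import Literature.NumberTheory.GaloisRepresentations.LocalOneUnitsStructureProofs
import Literature.NumberTheory.GaloisRepresentations.GaloisRep
import Literature.AnabelianGeometry.AbsoluteAnabelian.AbsTopIII.KummerFaithful
import HarnessLib

/-!
# [AbsTopIII] Remark 1.5.1 — DISCHARGE of `Rmk_1_5_1`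
# (torally Kummer-faithful ⟹ the `l`-adic cyclotomic character has open image)

Proof-only companion of `AbsTopIII/KummerFaithful.lean` (abc-iut-L4-t1, p404026; never edited
here).  S. Mochizuki, *Topics in Absolute Anabelian Geometry III*, Rmk. 1.5.1, kurims manuscript
p. 32 (lit key `paper:url-5493eb38cbb7`) [cite: MochizukiAbsTopIII2015, Rmk 1.5.1 p.32]:
"suppose that `k` is a torally Kummer-faithful field, `l` a prime number. Then it is not
difficult to verify that the torally Kummer-faithful hypothesis implies the cyclotomic character
`χ_l : G_k → ℤ_l^×` has open image".  The tree types this as the named fact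
`Rmk_1_5_1 : ∀ k, IsTorallyKummerFaithful k → ∀ l prime, IsOpen (range (cyclotomicChar k l))`
(abc-iut node `AbsTopIII:Rmk1.5.1`).  This file PROVES it (`Rmk_1_5_1_holds`).

## Proof (ours)

1. (`(ℤ_l, +)`) A non-zero closed additive subgroup of `ℤ_l` is open
   (`PadicInt.isOpen_of_isClosed_addSubgroup`): `ℕ` is dense in `ℤ_l`, so a closed subgroup is
   a `ℤ_l`-submodule, i.e. a non-zero ideal `l^n ℤ_l` (Mathlib `PadicInt.ideal_eq_span_pow_p`),
   a closed ball of positive radius.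
2. (`ℤ_lˣ`) A closed subgroup `H` of `ℤ_lˣ` is finite or open
   (`PadicInt.finite_or_isOpen_of_isClosed_subgroup_units`): by the tree's structure theorem for
   higher one-units (`OneUnits.exists_subgroup_continuousMulEquiv`, here `U₂ = 1 + l²ℤ_l ≃ₜ* ℤ_l`,
   open of finite index), `H ∩ U₂` corresponds to a closed additive subgroup `Λ` of `ℤ_l`; if
   `Λ = 0` then `H` embeds in the finite `ℤ_lˣ/U₂`, otherwise `Λ`, `H ∩ U₂` and `H` are open.
3. (`μ_{l^∞}` is divisible) an `l`-th root of unity has, for every `N ≥ 1`, an `N`-th root among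
   the `l`-power roots of unity (`exists_lPowerRoot_pow_eq`).
4. (`Rmk_1_5_1_holds`) `χ_l` is continuous (Mathlib `cyclotomicCharacter.continuous`, through the
   tree's `GaloisRep.cyclotomicCharacter`, definitionally t1's `cyclotomicChar`), so its image is
   compact, hence closed; if it is not open it is finite by 2, so `ker χ_l` is open and its fixed
   field `L` is a finite extension of `k` (Krull correspondence, as in the tree's
   `cyclotomicCharacter_range_infinite_of_valuation_lt_one`) containing `μ_{l^∞}(k̄)`; by 3 a
   primitive `l`-th root of unity `ζ ≠ 1` lies in `⋂_N (Lˣ)^N`, contradicting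
   `DivisibleElementsTrivial Lˣ` (toral Kummer-faithfulness of `k` applied to `L/k`).

Steps 1–2 are folklore consequences of `ℤ_lˣ ≅ μ × ℤ_l` (Neukirch, *Algebraic Number Theory*,
Ch. II (5.7)).  Theorems only: no new definitions, no named facts.
-/

noncomputable section

open Topology Metric

namespace Literature.AnabelianGeometry.AbsoluteAnabelian.AbsTopIII

universe u

variable {l : ℕ} [hl : Fact l.Prime]

/-! ### `(ℤ_l, +)` -/

/-- The ideal `l^n ℤ_l` is the closed ball of radius `l^{-n}`, hence open.
(Neukirch, *Algebraic Number Theory*, Ch. II §2; cf. `Summit.Ventures.HodgeRepro2.T5PadicOpenSubgroups`,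
not importable from `Literature/`). [folklore] -/
private theorem PadicInt.isOpen_span_pow (n : ℕ) :
    IsOpen ((Ideal.span {(l : ℤ_[l]) ^ n} : Ideal ℤ_[l]) : Set ℤ_[l]) := by
  have hset : ((Ideal.span {(l : ℤ_[l]) ^ n} : Ideal ℤ_[l]) : Set ℤ_[l]) =
      closedBall (0 : ℤ_[l]) ((l : ℝ) ^ (-(n : ℤ))) := by
    ext x
    rw [SetLike.mem_coe, ← PadicInt.norm_le_pow_iff_mem_span_pow, mem_closedBall, dist_zero_right]
  rw [hset]
  refine IsUltrametricDist.isOpen_closedBall _ (zpow_ne_zero _ ?_)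
  exact_mod_cast hl.out.ne_zero

/-- **A non-zero closed additive subgroup of `ℤ_l` is open.**  Since `ℕ` is dense in `ℤ_l` and
`Λ` is closed, `Λ` is stable under multiplication by `ℤ_l`, i.e. an ideal; a non-zero ideal of
`ℤ_l` is `l^n ℤ_l`, an open ball (Neukirch, *Algebraic Number Theory*, Ch. II (5.7); the step of
[AbsTopIII] Rmk. 1.5.1 it serves: "has open image"). [cite: MochizukiAbsTopIII2015, Rmk 1.5.1 p.32] -/
theorem PadicInt.isOpen_of_isClosed_addSubgroup (Λ : AddSubgroup ℤ_[l])
    (hc : IsClosed (Λ : Set ℤ_[l])) (hne : Λ ≠ ⊥) : IsOpen (Λ : Set ℤ_[l]) := by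
  -- `Λ` is stable under the `ℤ_l`-action
  have hsmul : ∀ (c : ℤ_[l]) {x : ℤ_[l]}, x ∈ Λ → c * x ∈ Λ := by
    intro c x hx
    let S : Set ℤ_[l] := (fun d : ℤ_[l] => d * x) ⁻¹' (Λ : Set ℤ_[l])
    have hS : IsClosed S := hc.preimage (continuous_id.mul continuous_const)
    have hnat : Set.range (Nat.cast : ℕ → ℤ_[l]) ⊆ S := by
      rintro _ ⟨n, rfl⟩
      change (n : ℤ_[l]) * x ∈ (Λ : Set ℤ_[l])
      rw [SetLike.mem_coe, ← nsmul_eq_mul]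
      exact Λ.nsmul_mem hx n
    have hdense : Dense S := PadicInt.denseRange_natCast.mono hnat
    have hSu : S = Set.univ := by rw [← hS.closure_eq, hdense.closure_eq]
    have hc' : c ∈ S := by rw [hSu]; exact Set.mem_univ c
    exact hc'
  -- hence an ideal
  let I : Ideal ℤ_[l] :=
    { carrier := Λ
      add_mem' := fun ha hb => Λ.add_mem ha hb
      zero_mem' := Λ.zero_mem
      smul_mem' := fun c _ hx => hsmul c hx }
  have hI : I ≠ ⊥ := by
    intro h
    apply hne
    rw [eq_bot_iff]
    intro x hx
    have hx' : x ∈ I := hx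
    rw [h] at hx'
    rw [AddSubgroup.mem_bot]
    simpa using hx'
  obtain ⟨n, hn⟩ := PadicInt.ideal_eq_span_pow_p hI
  have hset : (Λ : Set ℤ_[l]) = ((Ideal.span {(l : ℤ_[l]) ^ n} : Ideal ℤ_[l]) : Set ℤ_[l]) := by
    rw [← hn]; rfl
  rw [hset]
  exact PadicInt.isOpen_span_pow n

/-! ### `ℤ_lˣ` -/

/-- `#(ℤ_l / l ℤ_l) = l` (Neukirch, *Algebraic Number Theory*, Ch. II §2). [folklore] -/
private theorem PadicInt.natCard_quotient_span_p :
    Nat.card (ℤ_[l] ⧸ (Ideal.span {(l : ℤ_[l])} : Ideal ℤ_[l])) = l := by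
  have e1 : (ℤ_[l] ⧸ (Ideal.span {(l : ℤ_[l])} : Ideal ℤ_[l])) ≃+*
      ℤ_[l] ⧸ IsLocalRing.maximalIdeal ℤ_[l] :=
    Ideal.quotEquivOfEq (PadicInt.maximalIdeal_eq_span_p (p := l)).symm
  have e2 : (ℤ_[l] ⧸ IsLocalRing.maximalIdeal ℤ_[l]) ≃+* ZMod l := PadicInt.residueField
  rw [Nat.card_congr (e1.trans e2).toEquiv, Nat.card_zmod]

/-- The hypotheses of the tree's one-unit structure theorem hold for `A = ℤ_l`: the higher
one-units `U₂ = 1 + l² ℤ_l ≤ ℤ_lˣ` form an open subgroup of finite index topologically isomorphic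
to `(ℤ_l, +)` (Neukirch, *Algebraic Number Theory*, Ch. II (5.7) (i); auxiliary for [AbsTopIII]
Rmk. 1.5.1). [cite: MochizukiAbsTopIII2015, Rmk 1.5.1 p.32] -/
theorem PadicInt.exists_oneUnits_continuousMulEquiv :
    ∃ W : Subgroup ℤ_[l]ˣ, IsOpen (W : Set ℤ_[l]ˣ) ∧ W.FiniteIndex ∧
      Nonempty (W ≃ₜ* Multiplicative (Fin 1 → ℤ_[l])) := by
  have hp : l.Prime := hl.out
  have hreg : ∀ a : ℤ_[l], (l : ℤ_[l]) * a = 0 → a = 0 := fun a ha => by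
    rcases mul_eq_zero.mp ha with h | h
    · exact absurd h (by exact_mod_cast hp.ne_zero)
    · exact h
  have hunit : ∀ a : ℤ_[l], IsUnit (1 + (l : ℤ_[l]) * a) := by
    intro a
    rw [← IsLocalRing.notMem_maximalIdeal]
    intro hmem
    have hla : (l : ℤ_[l]) * a ∈ IsLocalRing.maximalIdeal ℤ_[l] := by
      rw [PadicInt.maximalIdeal_eq_span_p]
      exact Ideal.mul_mem_right _ _ (Ideal.mem_span_singleton_self _)
    have h1 : (1 : ℤ_[l]) ∈ IsLocalRing.maximalIdeal ℤ_[l] := by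
      have := Ideal.sub_mem _ hmem hla
      rwa [add_sub_cancel_right] at this
    exact (IsLocalRing.maximalIdeal.isMaximal ℤ_[l]).ne_top
      ((Ideal.eq_top_iff_one _).mpr h1)
  have hopen : ∀ m : ℕ, IsOpen ((Ideal.span {(l : ℤ_[l]) ^ m} : Ideal ℤ_[l]) : Set ℤ_[l]) :=
    PadicInt.isOpen_span_pow
  have hsep : ∀ a : ℤ_[l], (∀ m : ℕ, a ∈ Ideal.span {(l : ℤ_[l]) ^ m}) → a = 0 := by
    intro a ha
    by_contra hne
    have hpos : 0 < ‖a‖ := norm_pos_iff.mpr hne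
    obtain ⟨k, hk⟩ := PadicInt.exists_pow_neg_lt l hpos
    have hle := (PadicInt.norm_le_pow_iff_mem_span_pow a k).mpr (ha k)
    exact absurd (hle.trans_lt hk) (lt_irrefl _)
  obtain ⟨n, W, hcard, -, hWo, hWi, ⟨e⟩⟩ :=
    Literature.NumberTheory.GaloisRepresentations.OneUnits.exists_subgroup_continuousMulEquiv
      (A := ℤ_[l]) l hreg hunit hopen hsep
  have hn : n = 1 := by
    rw [PadicInt.natCard_quotient_span_p] at hcard
    exact (Nat.pow_right_injective hp.two_le (hcard.symm.trans (pow_one l).symm)).symm ▸ rfl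
  subst hn
  exact ⟨W, hWo, hWi, ⟨e⟩⟩


/-- **A closed subgroup of `ℤ_lˣ` is finite or open.**  With `W = U₂ ≃ₜ* ℤ_l` (open, finite
index), the closed subgroup `H ∩ W` of `W` corresponds to a closed additive subgroup `Λ` of `ℤ_l`:
if `Λ = 0` then `H ∩ W = 1` and `H` embeds in the finite quotient `ℤ_lˣ / W`; otherwise `Λ` is open
(`PadicInt.isOpen_of_isClosed_addSubgroup`), so `H ∩ W`, hence `H`, is open.
(Neukirch, *Algebraic Number Theory*, Ch. II (5.7) (i): `ℤ_lˣ ≅ μ × ℤ_l`; the group-theoretic input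
of [AbsTopIII] Rmk. 1.5.1.) [cite: MochizukiAbsTopIII2015, Rmk 1.5.1 p.32] -/
theorem PadicInt.finite_or_isOpen_of_isClosed_subgroup_units (H : Subgroup ℤ_[l]ˣ)
    (hc : IsClosed (H : Set ℤ_[l]ˣ)) : (H : Set ℤ_[l]ˣ).Finite ∨ IsOpen (H : Set ℤ_[l]ˣ) := by
  classical
  obtain ⟨W, hWo, hWi, ⟨e⟩⟩ := PadicInt.exists_oneUnits_continuousMulEquiv (l := l)
  -- the continuous injective homomorphism `Φ : W → ℤ_l` (multiplicative to additive)
  let ev : Multiplicative (Fin 1 → ℤ_[l]) →* Multiplicative ℤ_[l] :=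
    AddMonoidHom.toMultiplicative (Pi.evalAddMonoidHom (fun _ : Fin 1 => ℤ_[l]) 0)
  let Φ : W →* Multiplicative ℤ_[l] := ev.comp e.toMulEquiv.toMonoidHom
  have hΦcont : Continuous Φ := by
    have h1 : Continuous ev := continuous_apply (0 : Fin 1)
    exact h1.comp e.continuous
  have hev_inj : Function.Injective ev := by
    intro f g hfg
    have hfg' : (Multiplicative.toAdd f) 0 = (Multiplicative.toAdd g) 0 := hfg
    apply Multiplicative.toAdd.injective
    funext i
    rw [Subsingleton.elim i 0]
    exact hfg'
  have hΦinj : Function.Injective Φ := hev_inj.comp e.injective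
  -- the closed additive subgroup `Λ` of `ℤ_l`
  let H' : Subgroup W := H.subgroupOf W
  let Λm : Subgroup (Multiplicative ℤ_[l]) := H'.map Φ
  let Λ : AddSubgroup ℤ_[l] := Subgroup.toAddSubgroup Λm
  have hΛset : (Λ : Set ℤ_[l]) = Multiplicative.ofAdd ⁻¹' (Φ '' (H' : Set W)) := by
    ext x; rfl
  have hH'closed : IsClosed (H' : Set W) := by
    have : (H' : Set W) = ((↑) : W → ℤ_[l]ˣ) ⁻¹' (H : Set ℤ_[l]ˣ) := rfl
    rw [this]
    exact hc.preimage continuous_subtype_val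
  have hWcompact : CompactSpace W :=
    isCompact_iff_compactSpace.mp (Subgroup.isClosed_of_isOpen W hWo).isCompact
  have hΛclosed : IsClosed (Λ : Set ℤ_[l]) := by
    rw [hΛset]
    exact ((hH'closed.isCompact.image hΦcont).isClosed).preimage continuous_ofAdd
  by_cases hΛ : Λ = ⊥
  · -- `H ∩ W = 1`, so `H ↪ ℤ_lˣ / W` is finite
    left
    have hH'bot : ∀ w : W, w ∈ H' → w = 1 := by
      intro w hw
      have hΦw : Φ w ∈ Λm := ⟨w, hw, rfl⟩
      have hΦw' : Multiplicative.toAdd (Φ w) ∈ Λ := hΦw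
      rw [hΛ, AddSubgroup.mem_bot] at hΦw'
      apply hΦinj
      rw [map_one]
      exact Multiplicative.toAdd.injective hΦw'
    haveI : Finite (ℤ_[l]ˣ ⧸ W) := Subgroup.finite_quotient_of_finiteIndex
    have hinj : Function.Injective (fun h : H => (QuotientGroup.mk (h : ℤ_[l]ˣ) : ℤ_[l]ˣ ⧸ W)) := by
      intro a b hab
      have hmem : (a : ℤ_[l]ˣ)⁻¹ * b ∈ W := QuotientGroup.eq.mp hab
      have hmemH : (a : ℤ_[l]ˣ)⁻¹ * b ∈ H := H.mul_mem (H.inv_mem a.2) b.2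
      have h1 : (⟨(a : ℤ_[l]ˣ)⁻¹ * b, hmem⟩ : W) = 1 :=
        hH'bot ⟨_, hmem⟩ (Subgroup.mem_subgroupOf.mpr hmemH)
      have h2 : (a : ℤ_[l]ˣ)⁻¹ * b = 1 := congrArg Subtype.val h1
      exact Subtype.ext (inv_mul_eq_one.mp h2)
    exact (Set.finite_coe_iff.mp (Finite.of_injective _ hinj))
  · -- `Λ` is open, hence so are `H ∩ W` and `H`
    right
    have hΛopen : IsOpen (Λ : Set ℤ_[l]) := PadicInt.isOpen_of_isClosed_addSubgroup Λ hΛclosed hΛ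
    -- `H' = Φ ⁻¹' Λm` is open in `W`
    have hH'open : IsOpen (H' : Set W) := by
      have hpre : (H' : Set W) = Φ ⁻¹' (Multiplicative.toAdd ⁻¹' (Λ : Set ℤ_[l])) := by
        rw [hΛset]
        ext w
        constructor
        · intro hw; exact ⟨w, hw, rfl⟩
        · rintro ⟨w', hw', hww'⟩
          have : w' = w := hΦinj hww'
          rw [← this]; exact hw'
      rw [hpre]
      exact (hΛopen.preimage continuous_toAdd).preimage hΦcont
    -- its image in `ℤ_lˣ` is open and contained in `H`
    have hWH : IsOpen (((↑) : W → ℤ_[l]ˣ) '' (H' : Set W)) :=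
      (hWo.isOpenEmbedding_subtypeVal).isOpenMap _ hH'open
    have hsub : ((↑) : W → ℤ_[l]ˣ) '' (H' : Set W) ⊆ (H : Set ℤ_[l]ˣ) := by
      rintro _ ⟨w, hw, rfl⟩
      exact Subgroup.mem_subgroupOf.mp hw
    have h1 : (1 : ℤ_[l]ˣ) ∈ ((↑) : W → ℤ_[l]ˣ) '' (H' : Set W) :=
      ⟨1, H'.one_mem, rfl⟩
    exact Subgroup.isOpen_of_mem_nhds H (Filter.mem_of_superset (hWH.mem_nhds h1) hsub)


/-! ### `l`-power roots of unity form a divisible group -/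

/-- In an algebraically closed field, an `l`-th root of unity `ζ` has, for every `N ≥ 1`, an
`N`-th root `η` which is again an `l`-power root of unity (`μ_{l^∞} ≅ ℚ_l/ℤ_l` is divisible:
write `N = l^a m` with `l ∤ m`, take `ξ^{l^a} = ζ` and `η = ξ^{m'}` with `m m' ≡ 1 (mod l^{a+1})`).
[cite: MochizukiAbsTopIII2015, Rmk 1.5.1 p.32] -/
theorem exists_lPowerRoot_pow_eq {K : Type*} [Field K] [IsAlgClosed K]
    {ζ : K} (hζ : ζ ^ l = 1) {N : ℕ} (hN : 0 < N) :
    ∃ η : K, (∃ n : ℕ, η ^ l ^ (n + 1) = 1) ∧ η ^ N = ζ := by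
  have hl' : l.Prime := hl.out
  obtain ⟨a, m, hlm, hNam⟩ := Nat.exists_eq_pow_mul_and_not_dvd hN.ne' l hl'.ne_one
  obtain ⟨ξ, hξ⟩ := IsAlgClosed.exists_pow_nat_eq ζ (pow_pos hl'.pos a)
  have hξpow : ξ ^ l ^ (a + 1) = 1 := by rw [pow_succ, pow_mul, hξ, hζ]
  have hcop : Nat.Coprime m (l ^ (a + 1)) :=
    Nat.Coprime.pow_right _ ((Nat.Prime.coprime_iff_not_dvd hl').mpr hlm).symm
  have hlt : 1 < l ^ (a + 1) := Nat.one_lt_pow (Nat.succ_ne_zero a) hl'.one_lt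
  obtain ⟨m', -, hm'⟩ := Nat.exists_mul_mod_eq_one_of_coprime hcop hlt
  -- `ξ ^ (m * m') = ξ`
  have hξmm : ξ ^ (m * m') = ξ := by
    have hdiv : m * m' = l ^ (a + 1) * (m * m' / l ^ (a + 1)) + 1 := by
      have := Nat.div_add_mod (m * m') (l ^ (a + 1))
      rw [hm'] at this
      exact this.symm
    rw [hdiv, pow_add, pow_one, pow_mul, hξpow, one_pow, one_mul]
  refine ⟨ξ ^ m', ⟨a, ?_⟩, ?_⟩
  · rw [← pow_mul, mul_comm, pow_mul, hξpow, one_pow]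
  · rw [← pow_mul, hNam, show m' * (l ^ a * m) = (m * m') * l ^ a by ring, pow_mul, hξmm, hξ]

/-! ### Remark 1.5.1 -/

open Field Literature.NumberTheory.GaloisRepresentations in
/-- DISCHARGE of the named fact `Rmk_1_5_1` ([AbsTopIII] Rmk. 1.5.1 p. 32: for a torally
Kummer-faithful field `k` and a prime `l`, "the cyclotomic character `χ_l : G_k → ℤ_l^×` has open
image"), abc-iut node `AbsTopIII:Rmk1.5.1`.  Proof: `χ_l` is continuous (Mathlib), so its image is
a compact, hence closed, subgroup of `ℤ_lˣ`; if it were not open it would be finite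
(`PadicInt.finite_or_isOpen_of_isClosed_subgroup_units`), so `ker χ_l` would be an open subgroup
of `G_k` whose fixed field `L` is a finite extension of `k` (Krull correspondence) containing every
`l`-power root of unity of `k̄`; then a primitive `l`-th root of unity `ζ ≠ 1` is an `N`-th power
in `Lˣ` for every `N ≥ 1` (`exists_lPowerRoot_pow_eq`), contradicting
`DivisibleElementsTrivial Lˣ`. [cite: MochizukiAbsTopIII2015, Rmk 1.5.1 p.32] -/
theorem Rmk_1_5_1_holds : Rmk_1_5_1.{u} := by
  intro k _ hk l hlk
  classical
  haveI : CharZero k := hk.charZero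
  haveI : NeZero l := ⟨hlk.out.ne_zero⟩
  by_contra hno
  set χ := GaloisRep.cyclotomicCharacter k l with hχdef
  have hχ : ∀ σ, cyclotomicChar k l σ = χ σ := fun σ => rfl
  have hrange : Set.range (cyclotomicChar k l) = (χ.toMonoidHom.range : Set ℤ_[l]ˣ) := by
    rw [MonoidHom.coe_range]
    ext x
    simp only [Set.mem_range, hχ]
    rfl
  have hclosed : IsClosed (χ.toMonoidHom.range : Set ℤ_[l]ˣ) := by
    rw [MonoidHom.coe_range]
    exact (isCompact_range χ.continuous).isClosed
  rcases PadicInt.finite_or_isOpen_of_isClosed_subgroup_units _ hclosed with hfin | hopen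
  swap
  · exact hno (hrange ▸ hopen)
  rw [MonoidHom.coe_range] at hfin
  -- the kernel of `χ`: a closed subgroup of finite index, and its fixed field `L`
  set H : Subgroup (absoluteGaloisGroup k) := χ.toMonoidHom.ker with hH
  have hHclosed : IsClosed (H : Set (absoluteGaloisGroup k)) := by
    have : IsClosed ({1} : Set ℤ_[l]ˣ) := isClosed_singleton
    exact this.preimage χ.continuous
  set H' : Subgroup (AlgebraicClosure k ≃ₐ[k] AlgebraicClosure k) :=
    H.map (absoluteGaloisGroup.toAlgEquiv k).toMonoidHom with hH'
  have hH'closed : IsClosed (H' : Set (AlgebraicClosure k ≃ₐ[k] AlgebraicClosure k)) := by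
    have hHeq : (H' : Set (AlgebraicClosure k ≃ₐ[k] AlgebraicClosure k)) =
        (absoluteGaloisGroup.toAlgEquiv k).symm ⁻¹' H := by
      rw [hH', Subgroup.coe_map]
      exact (absoluteGaloisGroup.toAlgEquiv k).toEquiv.image_eq_preimage_symm _
    rw [hHeq]
    exact hHclosed.preimage continuous_id
  set L := IntermediateField.fixedField H' with hL
  have hfix : L.fixingSubgroup = H' := InfiniteGalois.fixingSubgroup_fixedField ⟨H', hH'closed⟩
  have hcard : Nat.card χ.toMonoidHom.range = Nat.card (Set.range χ) := rfl
  have hindex : Module.finrank k L = Nat.card (Set.range χ) := by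
    rw [IntermediateField.finrank_eq_fixingSubgroup_index, hfix, hH',
      Subgroup.index_map_of_bijective (absoluteGaloisGroup.toAlgEquiv k).bijective, hH,
      Subgroup.index_ker, hcard]
  haveI : Finite (Set.range χ) := hfin.to_subtype
  haveI : Nonempty (Set.range χ) := ⟨⟨χ 1, 1, rfl⟩⟩
  have hpos : 0 < Module.finrank k L := by rw [hindex]; exact Nat.card_pos
  haveI : FiniteDimensional k L := Module.finite_of_finrank_pos hpos
  -- every `l`-power root of unity of `k̄` lies in `L`
  have hmemL : ∀ (n : ℕ) (t : AlgebraicClosure k), t ^ l ^ (n + 1) = 1 → t ∈ L := by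
    intro n t ht
    rw [hL, IntermediateField.mem_fixedField_iff]
    rintro f ⟨σ, hσ, rfl⟩
    rw [SetLike.mem_coe, hH, MonoidHom.mem_ker] at hσ
    change (absoluteGaloisGroup.toAlgEquiv k σ) t = t
    haveI : NeZero (l : k) := NeZero.charZero
    haveI : Fact (1 < l ^ (n + 1)) := ⟨Nat.one_lt_pow (Nat.succ_ne_zero n) hlk.out.one_lt⟩
    rw [← absoluteGaloisGroup.smul_def, GaloisRep.cyclotomicCharacter_spec k l σ t ht,
      show GaloisRep.cyclotomicCharacter k l σ = 1 from hσ, Units.val_one, map_one, ZMod.val_one,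
      pow_one]
  -- a primitive `l`-th root of unity `ζ ≠ 1` of `k̄`, in `L`
  haveI : NeZero ((l : ℕ) : k) := NeZero.charZero
  obtain ⟨ζ, hζ⟩ := HasEnoughRootsOfUnity.exists_primitiveRoot (AlgebraicClosure k) l
  have hζ1 : ζ ≠ 1 := hζ.ne_one hlk.out.one_lt
  have hζ0 : ζ ≠ 0 := hζ.ne_zero hlk.out.ne_zero
  have hζL : ζ ∈ L := hmemL 0 ζ (by rw [zero_add, pow_one]; exact hζ.pow_eq_one)
  -- it is infinitely divisible in `Lˣ`, contradicting toral Kummer-faithfulness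
  have hdiv : DivisibleElementsTrivial (L : Type u)ˣ := hk.units L inferInstance
  have hζL0 : (⟨ζ, hζL⟩ : L) ≠ 0 := fun h => hζ0 (congrArg Subtype.val h)
  set x : (L : Type u)ˣ := Units.mk0 _ hζL0 with hx
  have hx1 : x ≠ 1 := by
    intro h
    apply hζ1
    have h' := congrArg (fun u : (L : Type u)ˣ => ((u : L) : AlgebraicClosure k)) h
    simpa [hx] using h'
  refine hx1 (hdiv.eq_one_of_forall_exists_pow x fun N hN => ?_)
  obtain ⟨η, ⟨n, hn⟩, hηN⟩ := exists_lPowerRoot_pow_eq (l := l) hζ.pow_eq_one hN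
  have hηL : η ∈ L := hmemL n η hn
  have hη0 : η ≠ 0 := by
    rintro rfl
    rw [zero_pow hN.ne'] at hηN
    exact hζ0 hηN.symm
  have hηL0 : (⟨η, hηL⟩ : L) ≠ 0 := fun h => hη0 (congrArg Subtype.val h)
  refine ⟨Units.mk0 _ hηL0, Units.ext (Subtype.ext ?_)⟩
  rw [Units.val_pow_eq_pow_val, Units.val_mk0, hx, Units.val_mk0, SubmonoidClass.coe_pow, hηN]

end Literature.AnabelianGeometry.AbsoluteAnabelian.AbsTopIII
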